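import Summits.CriticalPhenomena.PercolationContinuityZ3.Theorems.PercNearOneGluingNoHeavyQuantGatedSliceMixLawPDearThin
import Summits.CriticalPhenomena.PercolationContinuityZ3.Theorems.PercNearOneGluingNoHeavyQuantGatedSliceMixLawA5Fill
import Summits.CriticalPhenomena.PercolationContinuityZ3.Theorems.PercNearOneGluingNoHeavyQuantGatedSliceMixLawA5OfPDear
import Summits.CriticalPhenomena.PercolationContinuityZ3.Theorems.PercNearOneGluingNoHeavyQuantGatedSliceMixLawA5Assembly
import Summits.CriticalPhenomena.PercolationContinuityZ3.Theorems.PercNearOneGluingNoHeavyQuantGatedSliceMixLawThinC1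
import Summits.CriticalPhenomena.PercolationContinuityZ3.Theorems.PercNearOneGluingNoHeavyQuantGatedSliceMixLawThinBounds
import Summits.CriticalPhenomena.PercolationContinuityZ3.Theorems.PercNearOneGluingNoHeavyQuantGatedSliceMixLawThinDelta
import Summits.CriticalPhenomena.PercolationContinuityZ3.Theorems.PercNearOneGluingNoHeavyQuantGatedSliceMixLawThinC1Glue
import Summits.CriticalPhenomena.PercolationContinuityZ3.Theorems.PercNearOneGluingNoHeavyQuantGatedSliceMixLawTwinGapLB
import Summits.CriticalPhenomena.PercolationContinuityZ3.Theorems.PercNearOneGluingNoHeavyQuantGatedSliceMixLawThinGlue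
import HarnessLib

/-!
# QUANT lane R8, T-DEC, leg (III), blob case — `MixLawCellPDear` (hence `MixLawCellA5r`, `MixLawCellA5`): an INDEPENDENT SECOND PROOF via arm-2 g36's
# C1 route (the proof of record is arm-3 g116's `…A5rHolds`/`…A5Holds`, Positivstellensatz certificates, landed 45 minutes earlier)

builds on p205010 (kernel theorem, internal audit signed; external expert review pending)

Support file (`--supports stmt-CriticalPhenomena-4575`), QUANT lane lead seat prim-quant-lead (gen 33), rung R8 of
`run/shared/lean/prim/quant/LADDER.md`.  Lead g33 HANDOFF GEN-33 (late addendum).  Theorems only, standard axioms, no sorries.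

THE ASSEMBLY.  arm-2 g36 reduced census-2's regime-B P-alone cell `MixLawCellPDear` to the ∀-statement `hthin` of `mixLawCellPDear_of_thinKink`
((I_{U₁}) on the thin regime).  Inside that ∀: `a = 0` is vacuous (the no-top-room antecedent contradicts `t ≤ 2k₂`); for `a ≥ 1`, with the dear
closed form `U₁(k₂−t+k₁) = t−2k₁`: if the shifted low `ℓ = k₁ + a` is HEAVY at `k₂`, the lead's load bound (`loadBound_of_heavyShift`,
`movedTwoPoint_off_of_loadBound`, `…A5Fill`) gives (OFF) ≡ (I_{U₁}); if LIGHT, arm-2's C1 route, all of whose scalar pieces are kernel: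
`usage_twin_gap_lb` (B₁ ≥ LB1), `thin_X_of_B2_TA` → `thin_delta_low`, `thin_g_low`, `thin_eprime` → `thinC1'_of_bounds` → `thin_C1_of_core` (λ < ½;
for λ ≥ ½ (♦′) is immediate from `usage_twin_gap`) → (♦′) → `thin_IU1_of_diamond`.  Then `mixLawCellPDear_of_thinKink`, `mixLawCellA5r_of_PDear`,
`mixLawCellA5_of_residual`.

* **`LawDec.thinKink_IU1`** — the ∀ `hthin`, by the C1 route (no certificate search: every step is a named closed-form inequality).
* (`mixLawCellPDear_of_thinKink thinKink_IU1 : MixLawCellPDear` is then a second proof of the cell; not restated as a declaration — the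
  declarations of record are arm-3 g116's `mixLawCellPDear_holds` / `mixLawCellA5r_holds` / `mixLawCellA5_holds` in `…A5rHolds`, `…A5Holds`.)

HONEST STATUS: `MixLawCellPDear`, `MixLawCellA5r`, `MixLawCellA5` are theorems (twice); `GatedSliceMixLaw'` still needs `MixLawCellQK` (arm-1's
qk_Ib_lh), `MixLawCellBTwin`'s (PI), `MixLawCellBTopBelow`; CW, `GateMove`, `TreeDEC`, `FarTreeRow` OPEN; RATE class log* / honest sentence unchanged.

[this work]; the C1 route and the thin reduction: arm-2 g36; cells: census-2 g61, typer g30.  The gluing rows served [cite: KozmaNitzan2024,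
Conjecture 3 (p. 15)]; product measure [cite: Grimmett1999, §1.3 p. 10].
-/

noncomputable section

namespace Summit.CriticalPhenomena.PercolationContinuityZ3.Theorems

namespace Quant

open Finset

namespace LawDec

set_option maxHeartbeats 1600000 in
/-- **(I_{U₁}) ON THE THIN REGIME** — exactly the hypothesis `hthin` of `mixLawCellPDear_of_thinKink`. [this work] -/
theorem thinKink_IU1 (y z g S lam : ℝ) (a j k₁ k₂ : ℕ)
    (hy0 : 0 < y) (hy1 : y < 1) (hz0 : 0 ≤ z) (hz1 : z < 1) (hg0 : 0 ≤ g) (hg1 : g ≤ 1) (hyg : y ≤ (1 - z) * g)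
    (hlam0 : 0 ≤ lam) (hlam1 : lam < 1) (hk₂j : k₂ ≤ j) (hyk₂ : y * (k₂ : ℝ) ≤ S)
    (hmean : (1 - z) * ((k₁ : ℝ) + ((k₂ : ℝ) - k₁) * lam) = S)
    (hk₁low : 2 * (k₁ : ℝ) < S + (a : ℝ) * g * (1 - z)) (hPlow : 2 * ((k₁ + a : ℕ) : ℝ) < S + (a : ℝ) * g * (1 - z))
    (hk₂mid : S + (a : ℝ) * g * (1 - z) ≤ 2 * (k₂ : ℝ)) (hcomp : S + (a : ℝ) * g * (1 - z) < ((k₁ + a : ℕ) : ℝ) + k₂)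
    (hc1 : S + (a : ℝ) * g * (1 - z) < (k₁ : ℝ) + k₂)
    (hdear : y * ((k₂ : ℝ) - k₁) ≤ S + (a : ℝ) * g * (1 - z) - 2 * (k₁ : ℝ))
    (_hL : (1 - z) * lam * (1 - g) - usage y (S + (a : ℝ) * g * (1 - z)) j (k₁ + a) k₂ * ((1 - z) * (1 - lam) * g)
        < usage y (S + (a : ℝ) * g * (1 - z)) j k₁ k₂ * ((1 - z) * (1 - lam) * (1 - g)))
    (hDlow : y / (1 - y) * z < (1 - z) * lam * g)
    (hDhigh : (1 - z) * lam * g < y / (1 - y) * (z + (1 - z) * (1 - lam) * (1 - g)))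
    (hB2 : (S + (a : ℝ) * g * (1 - z) - 2 * (k₁ : ℝ)) * ((1 - y) / y) < (k₂ : ℝ) + a - (S + (a : ℝ) * g * (1 - z)))
    (htop : S * ((k₂ : ℝ) - k₁) < (S + (a : ℝ) * g * (1 - z) - 2 * (k₁ : ℝ)) * (k₂ : ℝ)) :
    usage y (S + (a : ℝ) * g * (1 - z)) j k₁ k₂ * (z + (1 - z) * (1 - lam) * (1 - g))
        + usage y (S + (a : ℝ) * g * (1 - z)) j (k₁ + a) k₂ * ((1 - z) * (1 - lam) * g)
      ≤ (1 - z) * lam * (1 - g) + usage y (S + (a : ℝ) * g * (1 - z)) j k₁ k₂ * ((1 - y) / y) * ((1 - z) * lam * g) := by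
  set t : ℝ := S + (a : ℝ) * g * (1 - z) with ht
  set U1 : ℝ := usage y t j k₁ k₂ with hU1d
  set Ud : ℝ := usage y t j (k₁ + a) k₂ with hUdd
  set A : ℝ := (1 - z) * (1 - lam) * (1 - g) with hA
  set B : ℝ := (1 - z) * (1 - lam) * g with hB
  set C : ℝ := (1 - z) * lam * (1 - g) with hC
  set D : ℝ := (1 - z) * lam * g with hD
  have h1z : 0 < 1 - z := by linarith
  have h1y : 0 < 1 - y := by linarith
  have hu0 : 0 < y / (1 - y) := div_pos hy0 h1y
  have ha0 : (0 : ℝ) ≤ a := Nat.cast_nonneg a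
  have hk₁0 : (0 : ℝ) ≤ k₁ := Nat.cast_nonneg k₁
  have hk₂0 : (0 : ℝ) ≤ k₂ := Nat.cast_nonneg k₂
  have hdcast : ((k₁ + a : ℕ) : ℝ) = (k₁ : ℝ) + a := by push_cast; ring
  have hB0 : 0 ≤ B := mul_nonneg (mul_nonneg h1z.le (by linarith)) hg0
  have hC0 : 0 ≤ C := mul_nonneg (mul_nonneg h1z.le hlam0) (by linarith)
  have hD0 : 0 ≤ D := mul_nonneg (mul_nonneg h1z.le hlam0) hg0
  have hp0 : 0 < t - 2 * (k₁ : ℝ) := by linarith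
  have hq0 : 0 < (k₂ : ℝ) - t + k₁ := by linarith
  -- a = 0 is vacuous
  rcases Nat.eq_zero_or_pos a with ha0' | ha1
  · exfalso
    subst ha0'
    have htS : t = S := by rw [ht]; push_cast; ring
    rw [htS] at htop hk₂mid
    have h1 : (k₁ : ℝ) * (2 * (k₂ : ℝ) - S) ≥ 0 := mul_nonneg hk₁0 (by linarith only [hk₂mid])
    nlinarith only [htop, h1]
  have ha1r : (1 : ℝ) ≤ a := by exact_mod_cast ha1
  -- g > 0 (from u z < D)
  have hg0' : 0 < g := by
    by_contra hc
    have hg00 : g = 0 := le_antisymm (not_lt.1 hc) hg0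
    have : D = 0 := by rw [hD, hg00]; ring
    have h2 : 0 ≤ y / (1 - y) * z := mul_nonneg hu0.le hz0
    rw [this] at hDlow; linarith only [hDlow, h2]
  -- B₂ > 0 in product form, top-affordability of the giant
  have hB2' : (t - 2 * (k₁ : ℝ)) * (1 - y) < y * ((k₂ : ℝ) + a - t) := by
    have e : (t - 2 * (k₁ : ℝ)) * ((1 - y) / y) * y = (t - 2 * (k₁ : ℝ)) * (1 - y) := by field_simp
    have := mul_lt_mul_of_pos_right hB2 hy0
    rw [e] at this; linarith only [this]
  have hGt : 0 < (k₂ : ℝ) + a - t := by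
    by_contra hc
    have h2 : y * ((k₂ : ℝ) + a - t) ≤ 0 := mul_nonpos_of_nonneg_of_nonpos hy0.le (not_lt.1 hc)
    have h3 : 0 ≤ (t - 2 * (k₁ : ℝ)) * (1 - y) := mul_nonneg hp0.le h1y.le
    linarith only [h2, h3, hB2']
  have htaG : y * ((k₂ : ℝ) + a) ≤ t := by
    have h2 : y * (a : ℝ) ≤ (a : ℝ) * g * (1 - z) := by nlinarith only [hyg, ha0]
    rw [ht]; linarith only [hyk₂, h2]
  -- the dear closed form of U₁
  have eU1 : U1 * ((k₂ : ℝ) - t + k₁) = t - 2 * (k₁ : ℝ) := by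
    rw [hU1d, usage_eq_heavy' y t j k₁ k₂ hy0 hy1 hk₂j hk₁low hc1 hdear, div_mul_eq_mul_div,
      div_eq_iff (show (k₁ : ℝ) + k₂ - t ≠ 0 by linarith)]
    ring
  have hk₁k₂ : k₁ < k₂ := by
    have : (k₁ : ℝ) < k₂ := by linarith
    exact_mod_cast this
  have hU1pos : 0 < U1 := usage_pos_of_compat y t j k₁ k₂ hy0 hy1 hk₁low hk₁k₂ (Or.inr hc1)
  -- bookkeeping identities of the five-atom law
  have hmass : z + A + B + C + D = 1 := by rw [hA, hB, hC, hD]; ring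
  have hmean' : (k₁ : ℝ) * A + ((k₁ : ℝ) + a) * B + (k₂ : ℝ) * C + ((k₂ : ℝ) + a) * D = t := by
    rw [hA, hB, hC, hD, ht, ← hmean]; ring
  have hTA : y / (1 - y) * (((k₂ : ℝ) + a) - t) ≤ t := by
    rw [div_mul_eq_mul_div, div_le_iff₀ h1y]
    have e : y * (((k₂ : ℝ) + a) - t) = y * ((k₂ : ℝ) + a) - y * t := by ring
    rw [e]; nlinarith only [htaG, hy0, hp0, hk₁0]
  -- (e′) and k₁ ≤ a
  have heprime : (k₁ : ℝ) * (2 * (k₂ : ℝ) - t) ≤ (a : ℝ) * g * (1 - z) * ((k₂ : ℝ) - k₁) :=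
    thin_eprime S t ((a : ℝ) * g * (1 - z)) k₁ k₂ (by rw [ht]) htop
  have hagc_le : (a : ℝ) * g * (1 - z) ≤ a := by
    have h2 : g * (1 - z) ≤ 1 := by nlinarith only [hg0, hg1, hz0, hz1]
    have h3 := mul_le_mul_of_nonneg_left h2 ha0
    linarith only [h3, show (a : ℝ) * g * (1 - z) = a * (g * (1 - z)) by ring]
  have hk₁a : k₁ ≤ a := by
    have hd0 : 0 < (k₂ : ℝ) - k₁ := by linarith
    have h1 : (k₁ : ℝ) * ((k₂ : ℝ) - k₁) ≤ (k₁ : ℝ) * (2 * (k₂ : ℝ) - t) :=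
      mul_le_mul_of_nonneg_left (by linarith only [hc1]) hk₁0
    have h2 : (k₁ : ℝ) * ((k₂ : ℝ) - k₁) ≤ (a : ℝ) * ((k₂ : ℝ) - k₁) := by
      have h4 := mul_le_mul_of_nonneg_right hagc_le hd0.le
      linarith only [h1, heprime, h4]
    have : (k₁ : ℝ) ≤ a := le_of_mul_le_mul_right h2 hd0
    exact_mod_cast this
  -- target in (OFF)-equivalent form: it suffices to show U1(z+A) + Ud B ≤ C + U1 D/u
  suffices hI : U1 * (z + A) + Ud * B ≤ C + U1 * D / (y / (1 - y)) by
    have e : U1 * D / (y / (1 - y)) = U1 * ((1 - y) / y) * D := by field_simp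
    rw [e] at hI; exact hI
  by_cases hlight : t - 2 * ((k₁ + a : ℕ) : ℝ) < y * ((k₂ : ℝ) - ((k₁ + a : ℕ) : ℝ))
  · ---------------- LIGHT shifted low: arm-2's C1 route ----------------
    set d : ℝ := (k₂ : ℝ) - k₁ with hdd
    set q : ℝ := (k₂ : ℝ) - t + k₁ with hqd
    have hd0 : 0 < d := by rw [hdd]; linarith
    have hd2a : 2 * (a : ℝ) < d := by rw [hdd]; rw [hdcast] at hPlow; linarith
    have hda : 0 < d - a := by linarith
    -- B₁ ≥ LB1
    have hLB := usage_twin_gap_lb y t j a k₁ k₂ hy0 hy1 hk₂j hk₁low hPlow hk₂mid hcomp hc1 hdear hlight.le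
    rw [← hUdd] at hLB
    -- P := q (k₁ d² + a (k₂ − a) q)
    set P : ℝ := ((k₁ : ℝ) + k₂ - t) * ((k₁ : ℝ) * ((k₂ : ℝ) - k₁) ^ 2 + (a : ℝ) * ((k₂ : ℝ) - a) * ((k₁ : ℝ) + k₂ - t)) with hPd
    have hB1P : P ≤ ((t - ((k₁ : ℝ) + a)) - q * Ud) * (d ^ 2 * (d - a)) := by
      have e : ((t - ((k₁ : ℝ) + a)) - q * Ud) * (d ^ 2 * (d - a))
          = (t - ((k₁ : ℝ) + a)) * (((k₂ : ℝ) - k₁) ^ 2 * ((k₂ : ℝ) - ((k₁ : ℝ) + a)))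
            - Ud * ((k₂ : ℝ) - t + k₁) * (((k₂ : ℝ) - k₁) ^ 2 * ((k₂ : ℝ) - ((k₁ : ℝ) + a))) := by
        rw [hdd, hqd]; ring
      rw [e]; linarith
    -- (♦′): 0 ≤ k₁ (C − A) + B₁ B
    have hdiamond : 0 ≤ (k₁ : ℝ) * (C - A) + ((t - ((k₁ : ℝ) + a)) - ((k₂ : ℝ) - t + k₁) * Ud) * B := by
      have hB1 : 0 ≤ (t - ((k₁ : ℝ) + a)) - ((k₂ : ℝ) - t + k₁) * Ud := by
        have := usage_twin_gap y t j a k₁ k₂ hy0 hy1 hk₂j hk₁low hPlow hk₂mid hcomp hc1 hdear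
        rw [← hUdd, hdcast] at this; linarith
      by_cases hlamhalf : 2 * lam < 1
      · -- λ < 1/2: C1 via (C1′)
        -- [X] and the two bounds
        have hX := thin_X_of_B2_TA y t S k₁ k₂ a hB2' hyk₂ hk₂0 (by linarith)
        have hX' : (t - 2 * (k₁ : ℝ)) * ((k₁ : ℝ) + d) ≤ S * ((k₁ : ℝ) + d + a - 2 * k₁) := by
          have e1 : (k₁ : ℝ) + d = k₂ := by linarith
          rw [e1]; exact hX
        have hS' : S = (1 - z) * ((k₁ : ℝ) + d * lam) := by linarith [hmean]
        have hdelta := thin_delta_low (1 - z) lam g k₁ a d S t h1z (by linarith) hlam0 hg0 hg1 hk₁0 (by linarith) hd0 hS'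
          ht (by rw [hdcast] at hPlow; linarith) (by linarith) hX'
        have hglow := thin_g_low y z g t k₁ k₂ a hy0 hy1.le hz0 hg0 hyg ha0 hk₁0 (by rw [hdcast] at hPlow; linarith) hc1 hB2'
        rw [← hdd] at hglow
        -- (C1′) at δ = q/d
        have hqd' : q = d - (t - 2 * (k₁ : ℝ)) := by rw [hqd, hdd]; ring
        have hδ0 : 0 ≤ q / d := div_nonneg hq0.le hd0.le
        have hδ1 : q / d ≤ 1 := by rw [div_le_one hd0, hqd']; linarith
        have hgd : 2 * (1 - q / d) ≤ 3 * g := by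
          have e : 2 * (1 - q / d) = 2 * (t - 2 * (k₁ : ℝ)) / d := by rw [hqd']; field_simp; ring
          rw [e, div_le_iff₀ hd0]; linarith only [hglow]
        have hdl : 2 - 3 * lam ≤ 2 * (q / d) := by
          have e : 2 * (q / d) = (2 * q) / d := by ring
          rw [e, le_div_iff₀ hd0, hqd']; linarith only [hdelta]
        have hC1' := thinC1'_of_bounds g lam (q / d) hlam0 hlam1.le hδ0 hδ1 hg0 hg1 hgd hdl
        -- (e′) in the form k₁(d+q) ≤ a g d
        have he : (k₁ : ℝ) * (d + q) ≤ (a : ℝ) * g * d := by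
          have e2 : d + q = 2 * (k₂ : ℝ) - t := by rw [hdd, hqd]; ring
          rw [e2]
          have hag : (a : ℝ) * g * (1 - z) ≤ (a : ℝ) * g := by nlinarith only [mul_nonneg ha0 hg0, hz0]
          have h2 : (a : ℝ) * g * (1 - z) * d ≤ (a : ℝ) * g * d := mul_le_mul_of_nonneg_right hag hd0.le
          have h3 : (k₁ : ℝ) * (2 * (k₂ : ℝ) - t) ≤ (a : ℝ) * g * (1 - z) * d := by rw [hdd]; exact heprime
          linarith only [h2, h3]
        have hC1 := thin_C1_of_core g lam k₁ a d q hk₁0 ha0 hd0 (by linarith) hq0.le hg0 hlam1.le he hC1'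
        -- combine: (♦′)·d²(d−a) ≥ (1−z)[ (1−λ) g · B₁ d²(d−a) − k₁(1−g)(1−2λ) d²(d−a) ] ≥ (1−z)[(1−λ) g P − P g (1−λ)] = 0
        have hPk : P = q * ((k₁ : ℝ) * d ^ 2 + (a : ℝ) * (d + k₁ - a) * q) := by rw [hPd, hqd, hdd]; ring
        have hdd2 : 0 < d ^ 2 * (d - a) := by positivity
        have key : 0 ≤ ((k₁ : ℝ) * (C - A) + ((t - ((k₁ : ℝ) + a)) - ((k₂ : ℝ) - t + k₁) * Ud) * B) * (d ^ 2 * (d - a)) := by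
          have e3 : ((k₁ : ℝ) * (C - A) + ((t - ((k₁ : ℝ) + a)) - ((k₂ : ℝ) - t + k₁) * Ud) * B) * (d ^ 2 * (d - a))
              = (1 - z) * ((1 - lam) * g * (((t - ((k₁ : ℝ) + a)) - q * Ud) * (d ^ 2 * (d - a)))
                  - (k₁ : ℝ) * (1 - g) * (1 - 2 * lam) * (d ^ 2 * (d - a))) := by
            rw [hA, hB, hC, hqd]; ring
          rw [e3]
          refine mul_nonneg h1z.le ?_
          have h7 : (1 - lam) * g * P ≤ (1 - lam) * g * (((t - ((k₁ : ℝ) + a)) - q * Ud) * (d ^ 2 * (d - a))) :=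
            mul_le_mul_of_nonneg_left hB1P (mul_nonneg (by linarith only [hlam1]) hg0)
          rw [hPk] at h7
          have e8 : (1 - lam) * g * (q * ((k₁ : ℝ) * d ^ 2 + (a : ℝ) * (d + k₁ - a) * q))
              = q * ((k₁ : ℝ) * d ^ 2 + (a : ℝ) * (d + k₁ - a) * q) * (g * (1 - lam)) := by ring
          rw [e8] at h7
          linarith only [hC1, h7]
        exact (mul_nonneg_iff_of_pos_right hdd2).1 key
      · -- λ ≥ 1/2: C ≥ A
        have h1g : (0:ℝ) ≤ 1 - g := by linarith only [hg1]
        have hCA : A ≤ C := by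
          rw [hA, hC]
          have : (1 - z) * (1 - lam) * (1 - g) ≤ (1 - z) * lam * (1 - g) := by
            have hl : 1 - lam ≤ lam := by linarith only [not_lt.1 hlamhalf]
            exact mul_le_mul_of_nonneg_right (mul_le_mul_of_nonneg_left hl h1z.le) h1g
          exact this
        have t1 := mul_nonneg hB1 hB0
        have t2 := mul_nonneg hk₁0 (sub_nonneg.2 hCA)
        linarith only [t1, t2]
    -- the glue
    exact thin_IU1_of_diamond z A B C D (y / (1 - y)) U1 Ud t k₁ ((k₁ : ℝ) + a) k₂ ((k₂ : ℝ) + a) hk₁0 hD0 hmass hmean' hq0 eU1 hu0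
      hTA hDhigh.le hdiamond
  · ---------------- HEAVY shifted low: the load bound ----------------
    have hheavyl : y * ((k₂ : ℝ) - ((k₁ + a : ℕ) : ℝ)) ≤ t - 2 * ((k₁ + a : ℕ) : ℝ) := not_lt.1 hlight
    have hLB := loadBound_of_heavyShift y t a j k₁ k₂ hy0 hy1 hk₁a hPlow hc1 hk₂j hheavyl
    have hoff := movedTwoPoint_off_of_loadBound y z g S lam a j k₁ k₂ hy0 hy1 hz0 hz1 hg0' hg1 ha1 hlam0 hlam1.le hmean hPlow hc1
      hk₂j htaG hdear hLB
    rw [← ht, ← hU1d, ← hUdd] at hoff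
    -- (OFF): y (z + A − (C − Ud B)/U1) ≤ (1 − y) D  ⟹  U1(z+A) + Ud B ≤ C + U1 D/u
    have hoff' : y * (z + A - (C - Ud * B) / U1) ≤ (1 - y) * D := by rw [hA, hB, hC, hD]; exact hoff
    have hX1 : z + A - (C - Ud * B) / U1 ≤ (1 - y) * D / y := by
      rw [le_div_iff₀ hy0]; linarith only [hoff']
    have hX2 := mul_le_mul_of_nonneg_left hX1 hU1pos.le
    have e3 : U1 * (z + A - (C - Ud * B) / U1) = U1 * (z + A) - (C - Ud * B) := by field_simp
    have e4 : C + U1 * D / (y / (1 - y)) = C + U1 * ((1 - y) * D / y) := by field_simp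
    rw [e4]; linarith only [hX2, e3]

end LawDec

end Quant

end Summit.CriticalPhenomena.PercolationContinuityZ3.Theorems
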